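import Summits.ABC.ABC.Theses.IsogenyGlueCongruence
import Literature.NumberTheory.EllipticCurves.PastenSpectralDegree

/-!
# Sketch — crux `PolyDegreeOfBoundedPrimes` (stmt-ABC-2046), crux-ideate round 1, ideator 2

First lemmas (signatures that elaborate; proofs are NOT claimed here) for the two idea cards

* `same-sign-contact-ledger`  (partner-class ledger: small classes / giant classes), and
* `lift-count-times-contact`  (per prime: number of partner classes × deepest contact).

Everything is stated over existing declarations: Pasten's Hecke-ring interface
(`anemicHeckeRing`, `eigenIdeal`, `heckeCongruenceModulus`, `finite_minimalPrimes_anemicHeckeRing`,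
`PastenShimura2024_thm_5_5`, `PastenShimura2024_minimalDegree_le_163_mul`) and the route decls
(`DegreePrimesPolyBounded`, `PolyDegreeOfBoundedPrimes`).
-/

noncomputable section

open scoped MatrixGroups ModularForm
open CongruenceSubgroup
open Literature.NumberTheory.EllipticCurves.ModularForms

namespace Summit.ABC.ABC.Cruxes.PolyDegreeOfBoundedPrimes.Sketch

/-! ### Objects -/

/-- Degree of the Hecke field of a class `[χ]` = `ℤ`-rank of `𝕋 ⧸ 𝕀_{[χ]}` (Pasten §4.11: `χ(𝕋)` is an
order in a totally real field of degree `#[χ]`). "Small" vs "giant" partner classes are cut by this. -/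
def orbitRank {N : ℕ} [NeZero N] (P : Ideal (anemicHeckeRing N 2)) : ℕ :=
  Module.finrank ℤ (anemicHeckeRing N 2 ⧸ P)

/-- The partner classes of `f`: minimal primes of `𝕋` other than `𝕀_f`. -/
def partnerClasses {N : ℕ} [NeZero N] (f : CuspForm (Gamma0 N) 2) :
    Finset (Ideal (anemicHeckeRing N 2)) :=
  (finite_minimalPrimes_anemicHeckeRing N 2).toFinset.erase (eigenIdeal f)

/-- SIZE HYPOTHESIS in contact form: every prime dividing a contact modulus `η_f(P)` of the newform of
`W` at level `N = N_W` is `≤ C·N^κ`.  (Under crux A = `DegreePrimesPolyBounded` this holds for odd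
primes, via `CongruencePrimesDivideDegree` below.) -/
def ContactPrimesBounded (κ C : ℝ) (W : WeierstrassCurve ℚ) [W.IsElliptic]
    [NeZero (W.conductorNorm ℤ)]
    (D : ModularParametrizationData W (W.conductorNorm ℤ)) : Prop :=
  ∀ P ∈ partnerClasses D.f, ∀ ℓ : ℕ, ℓ.Prime → ℓ ≠ 2 → ℓ ∣ heckeCongruenceModulus D.f P →
    (ℓ : ℝ) ≤ C * (W.conductorNorm ℤ : ℝ) ^ κ

/-- FACT-SHAPED (Ribet's lemma + Agashe–Ribet–Stein 2012 Thm 2.2, `ord_ℓ(r_E/m_E) ≤ ½ ord_ℓ(N)`):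
an odd prime dividing a contact modulus `η_f(P)` is a congruence prime of `f`, hence divides `r_f`,
hence divides the modular degree of every datum with newform `f` at squarefree level. -/
def CongruencePrimesDivideDegree : Prop :=
  ∀ (W : WeierstrassCurve ℚ) [W.IsElliptic] [W.IsGloballyMinimal] [NeZero (W.conductorNorm ℤ)],
    W.IsSemistable ℤ → ∀ (D : ModularParametrizationData W (W.conductorNorm ℤ)),
    ∀ P ∈ partnerClasses D.f, ∀ ℓ : ℕ, ℓ.Prime → ℓ ≠ 2 →
      ℓ ∣ heckeCongruenceModulus D.f P → ℓ ∣ D.modularDegree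

/-! ### Card 1 — `same-sign-contact-ledger` -/

/-- SMALL-PARTNER BUDGET below the dimension cut `Δ`: the total contact of `f_W` with partner classes
of Hecke-field degree `≤ Δ(N)` is `O(log N)`, GIVEN that all contact primes are `≤ C N^κ`.
(Per class this is the isogeny-estimate regime of the route: Masser–Wüstholz / Gaudron–Rémond with
composite modulus; the open part is the COUNT of small partners — uniform Frey–Mazur type.) -/
def SmallPartnerBudget (Δ : ℕ → ℕ) : Prop :=
  ∀ κ C : ℝ, ∃ A B : ℝ, ∀ (W : WeierstrassCurve ℚ) [W.IsElliptic] [W.IsGloballyMinimal]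
    [NeZero (W.conductorNorm ℤ)], W.IsSemistable ℤ →
    ∀ D : ModularParametrizationData W (W.conductorNorm ℤ), ContactPrimesBounded κ C W D →
      ∑ P ∈ (partnerClasses D.f).filter (fun P => orbitRank P ≤ Δ (W.conductorNorm ℤ)),
          Real.log (heckeCongruenceModulus D.f P : ℝ)
        ≤ A * Real.log (W.conductorNorm ℤ : ℝ) + B

/-- GIANT-CONTACT BOUND above the cut `Δ`: the NEW conjecture-object of the card — the contact moduli of
`f_W` with the giant classes (Hecke-field degree `> Δ(N)`) have total `O(log N)`, given sizes. -/
def GiantContactBound (Δ : ℕ → ℕ) : Prop :=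
  ∀ κ C : ℝ, ∃ A B : ℝ, ∀ (W : WeierstrassCurve ℚ) [W.IsElliptic] [W.IsGloballyMinimal]
    [NeZero (W.conductorNorm ℤ)], W.IsSemistable ℤ →
    ∀ D : ModularParametrizationData W (W.conductorNorm ℤ), ContactPrimesBounded κ C W D →
      ∑ P ∈ (partnerClasses D.f).filter (fun P => Δ (W.conductorNorm ℤ) < orbitRank P),
          Real.log (heckeCongruenceModulus D.f P : ℝ)
        ≤ A * Real.log (W.conductorNorm ℤ : ℝ) + B

/-- FIRST LEMMA of card 1 (the ledger closes the crux): Pasten Thm 5.5 (`δ ∣ ∏ η`, reduced in the tree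
to Ribet's `m_E ∣ r_E`) + Mazur–Kenku (`deg_min(W) ≤ 163 δ`) + the two budgets + the congruence-prime
fact give `A → Poly`, i.e. the crux BY NAME.  Proof plan: fix `κ, C` from `A`; for `W` take the
optimal-degree datum; odd prime factors of each `η` divide `δ`, whose prime factors are those of the
`A`-datum's degree (`≤ C N^κ`) or `≤ 163`; split `∑_P log η` at `Δ`; exponentiate. -/
theorem polyDegreeOfBoundedPrimes_of_ledger (Δ : ℕ → ℕ)
    (h55 : PastenShimura2024_thm_5_5) (h163 : PastenShimura2024_minimalDegree_le_163_mul)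
    (hdiv : CongruencePrimesDivideDegree)
    (hS : SmallPartnerBudget Δ) (hG : GiantContactBound Δ) :
    Summit.ABC.ABC.Theses.IsogenyGlueCongruence.PolyDegreeOfBoundedPrimes := by
  sorry

/-! ### Card 2 — `lift-count-times-contact` -/

/-- ABSTRACT LEVER (reducedness only): for a `ℤ`-valued character `χ` of a commutative ring `T` and
ideals `J i` (the kernels of the other classes), the congruence ideal `χ(⋂ J i)` CONTAINS the product
of the pairwise congruence ideals `χ(J i)`.  Numerically: `η_f ∣ ∏_i η_f(J i)` prime by prime, and
`v_ℓ(η_f) ≤ ∑_i v_ℓ(η_f(J i)) ≤ #{i : ℓ ∣ η_f(J i)} · max_i v_ℓ(η_f(J i))`. -/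
theorem prod_map_le_map_iInf {T : Type*} [CommRing T] {ι : Type*} (s : Finset ι)
    (J : ι → Ideal T) (χ : T →+* ℤ) :
    ∏ i ∈ s, (J i).map χ ≤ (⨅ i ∈ s, J i).map χ := by
  classical
  induction s using Finset.induction_on with
  | empty => simp [Ideal.map_top]
  | insert a s ha ih =>
    rw [Finset.prod_insert ha, Finset.iInf_insert]
    calc Ideal.map χ (J a) * ∏ i ∈ s, Ideal.map χ (J i)
        ≤ Ideal.map χ (J a) * Ideal.map χ (⨅ i ∈ s, J i) := Ideal.mul_mono_right ih
      _ = Ideal.map χ (J a * ⨅ i ∈ s, J i) := (Ideal.map_mul χ _ _).symm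
      _ ≤ Ideal.map χ (J a ⊓ ⨅ i ∈ s, J i) := Ideal.map_mono Ideal.mul_le_inf

/-- ELEMENTARY COUNTING LEMMA behind "length ≤ (lift count) × (deepest contact)": if every prime divides
at most `A` of the `η i`, then `∏ η i ∣ (lcm η)^A`. -/
theorem prod_dvd_lcm_pow {ι : Type*} (s : Finset ι) (m : ι → ℕ) (A : ℕ)
    (hm : ∀ i ∈ s, m i ≠ 0)
    (hA : ∀ ℓ : ℕ, ℓ.Prime → (s.filter (fun i => ℓ ∣ m i)).card ≤ A) :
    ∏ i ∈ s, m i ∣ (s.lcm m) ^ A := by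
  sorry

open Classical in
/-- The N-NEW partner classes: eigen-ideals of newforms of exact level `N` other than `f` (old classes —
whose contacts with `f_E` are level-lowering = Tamagawa, Ribet 1990 + Pollack–Weston/RT — are excluded;
inter-sign contacts among N-new classes are 2-adic or at `ℓ ∣ p+1`, so no sign bookkeeping is needed for a
COUNT at `ℓ ≥ 11` beyond those primes). -/
def newPartnerClasses {N : ℕ} [NeZero N] (f : CuspForm (Gamma0 N) 2) :
    Finset (Ideal (anemicHeckeRing N 2)) :=
  (partnerClasses f).filter (fun P => ∃ g : CuspForm (Gamma0 N) 2, IsNewform0 g ∧ eigenIdeal g = P)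

open Classical in
/-- LIFT COUNT (the card's conjecture-object): at every prime `ℓ ≥ 11` the newform of a semistable curve
has at most `A` N-new partner CLASSES in contact with it at `ℓ` — uniformly in the curve and the level.
(`≤ rank_{ℤ_ℓ} 𝕋^{new}_𝔪 − 1`, `𝔪 ↔ ρ̄_{E,ℓ}`; by Wiles–Lenstra it counts the other N-new components of
`Spec R_Σ = Spec 𝕋_𝔪` — the multiplicity half of "depth × multiplicity"; old components are NOT counted:
with `k` primes `p ∣ N` at which `ℓ ∣ v_p(Δ)` there may be `2^k − 1` of them.) -/
def LiftCount : Prop :=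
  ∃ A : ℕ, ∀ (W : WeierstrassCurve ℚ) [W.IsElliptic] [W.IsGloballyMinimal]
    [NeZero (W.conductorNorm ℤ)], W.IsSemistable ℤ →
    ∀ (D : ModularParametrizationData W (W.conductorNorm ℤ)) (ℓ : ℕ), ℓ.Prime → 11 ≤ ℓ →
      ((newPartnerClasses D.f).filter (fun P => ℓ ∣ heckeCongruenceModulus D.f P)).card ≤ A

/-- OLD-CLASS BUDGET in PRODUCT form (stronger than the exact Ribet–Takahashi/Pollack–Weston accounting
`ord_ℓ m_E = ord_ℓ ξ_f + Σ_p ord_ℓ v_p(Δ)` + `pasten_thm_1_12`; it is what the product ledger over ALL classes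
needs; the faithful route replaces it by the N-new congruence number — definition request `newCongruenceNumber`). -/
def OldClassesBudget : Prop :=
  ∀ κ C : ℝ, ∃ A B : ℝ, ∀ (W : WeierstrassCurve ℚ) [W.IsElliptic] [W.IsGloballyMinimal]
    [NeZero (W.conductorNorm ℤ)], W.IsSemistable ℤ →
    ∀ D : ModularParametrizationData W (W.conductorNorm ℤ), ContactPrimesBounded κ C W D →
      ∑ P ∈ partnerClasses D.f \ newPartnerClasses D.f,
          Real.log (heckeCongruenceModulus D.f P : ℝ)
        ≤ A * Real.log (W.conductorNorm ℤ : ℝ) + B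

/-- CONTACT-EXPONENT BUDGET: the lcm (not the product) of the contact moduli — the EXPONENT of the
congruence module `⊕_P ℤ/η_f(P)` — is polynomial in `N`, given sizes.  Weaker than
`SmallPartnerBudget ∧ GiantContactBound` (max instead of sum at each prime). -/
def ContactExponentBudget : Prop :=
  ∀ κ C : ℝ, ∃ A B : ℝ, ∀ (W : WeierstrassCurve ℚ) [W.IsElliptic] [W.IsGloballyMinimal]
    [NeZero (W.conductorNorm ℤ)], W.IsSemistable ℤ →
    ∀ D : ModularParametrizationData W (W.conductorNorm ℤ), ContactPrimesBounded κ C W D →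
      Real.log ((newPartnerClasses D.f).lcm (fun P => heckeCongruenceModulus D.f P) : ℝ)
        ≤ A * Real.log (W.conductorNorm ℤ : ℝ) + B

/-- EISENSTEIN-PRIMES BUDGET (`ℓ ≤ 7`, where `ρ̄_{E,ℓ}` may be reducible and `LiftCount` is not asked):
the `{2,3,5,7}`-part of the minimal modular degree is polynomial in `N`. (Sibling cruxes XiBound /
XiStrongBound carry dedicated cards for `ℓ = 2, 3`; filed here as the residual item.) -/
def EisensteinPrimesBudget : Prop :=
  ∃ A B : ℝ, ∀ (W : WeierstrassCurve ℚ) [W.IsElliptic] [W.IsGloballyMinimal]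
    [NeZero (W.conductorNorm ℤ)], W.IsSemistable ℤ →
    ∃ D : ModularParametrizationData W (W.conductorNorm ℤ),
      Real.log ((2 : ℝ) ^ (D.modularDegree.factorization 2) * 3 ^ (D.modularDegree.factorization 3)
          * 5 ^ (D.modularDegree.factorization 5) * 7 ^ (D.modularDegree.factorization 7))
        ≤ A * Real.log (W.conductorNorm ℤ : ℝ) + B

/-- FIRST LEMMA of card 2: `A ∧ LiftCount ∧ ContactExponentBudget ∧ EisensteinPrimesBudget ⟹ Poly`
through `δ ∣ ∏_P η_f(P) ∣ (lcm_P η_f(P))^{A₀}` away from `{2,3,5,7}` (`prod_dvd_lcm_pow`), Pasten 5.5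
and Mazur–Kenku; concludes the crux BY NAME. -/
theorem polyDegreeOfBoundedPrimes_of_liftCount
    (h55 : PastenShimura2024_thm_5_5) (h163 : PastenShimura2024_minimalDegree_le_163_mul)
    (hdiv : CongruencePrimesDivideDegree) (hold : OldClassesBudget)
    (hL : LiftCount) (hE : ContactExponentBudget) (h7 : EisensteinPrimesBudget) :
    Summit.ABC.ABC.Theses.IsogenyGlueCongruence.PolyDegreeOfBoundedPrimes := by
  sorry

end Summit.ABC.ABC.Cruxes.PolyDegreeOfBoundedPrimes.Sketch

end
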